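import Summits.AtomisticToContinuum.HydrodynamicLimit.Theorems.MourreKoopmanChargesLinearToEntropyInBandWindowClauseFrozenSplit
import Summits.AtomisticToContinuum.HydrodynamicLimit.Theorems.OneFlightGossipEngineClampedCurrentsDockHeartPathwise
import HarnessLib

/-!
# Route `MourreKoopmanCharges`, crux `LinearToEntropyInBand` (stmt-AtomisticToContinuum-17740), skeleton v8:
# stub 4a-ii, FREEZE ∘ frozen split — the pathwise one-window decomposition inequality (plan § 1 (1)–(2), § 2 (a))

Support file (`--supports stmt-AtomisticToContinuum-17740`; registered helper `stub_windowClauseFreeze`; worker of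
lead prover-line-…-17740-c6-0, wave 1; plan `Cruxes/LinearToEntropyInBand/WINDOWCLAUSE-PLAN.md` § 1 (0)–(2), § 2 (a)).

On ONE window `[s, s + w]`, `w = τ (N+1)^{-1/3}`, `0 < τ`, along a good orbit `z ∈ Φ.good`, the entropy production
`−(Str + Col)` of the one-window balance (C0; `Str = ∫_s^{s+w} Σᵢ Dg_r(Φ_r z i) dr`, `Col = collisionSum (Ioc s (s+w)) Kt z`
with the TRUE pair kernel `Kt`) is bounded by FREEZING the profiles at the window start `s`:

* step (1), FREEZE = `ClampedCurrentsDockHeart.heart_pathwise` with `lo := fast s`, `hi := 0` (so `|∫Σ hi| = 0`):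
  `−(Str + Col) ≤ −∫Σ fast_s + (∫Σ P_s − collisionSum Ksf) + C_fz w ∫Σ(3 + 2‖v‖³) + 2B Σᵢ collisionSum actᵢ`, given
  `Dg_r = fast_r − P_r` on the window, the time-Lipschitz freeze bounds of `fast`, `P` and the kernel bound
  `|Kt − Ksf| ≤ B (‖Δv‖ + |Δ‖v‖²|/2)` against the FROZEN pair kernel `Ksf` of `(u, θ) = (u_s, θ_s)` (asked here at
  every time of `(s, s + w]` and every contact pair — the heart uses it at the collision times only; it is the
  deterministic contact-scale Lipschitz estimate `ClampedCurrentsDockHeart.abs_pairKernelGen_le` downstream);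
* the frozen streaming rate splits as `Dg_s = dt_s + kin` — its `∂ₜ`-part `dt_s` (`= ∂ₜλ_s · (1, v, ‖v‖²/2)`,
  `…WindowClauseEulerStructure.timeDeriv_gExp_eq_affine`; `dt` is a time family like `Dg`, used at `s`) plus the
  one-particle kinetic current `kin = ⟪∇λ⁰, v⟫ + Σ_j ⟪∇(u_j/θ), v⟫ v_j + ⟪∇(−θ⁻¹), v⟫ ‖v‖²/2`
  (M2 `kineticPart_gExp_eq_visKin_summand`) — taken here as the pointwise hypothesis `hDgs`, abstract in `dt`;
* step (2), the FROZEN SPLIT `LTEInBand.frozen_split` (M4a, landed):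
  `∫Σ kin + collisionSum Ksf = w · visCoreN(∇λ_s) + ∫ visFluxN + ∫ Σ_(invisible) kin + (collisionSum Ksf − Σᶠ visCollN)`.

Conclusion (`freeze_frozen_split`, the decomposition inequality of plan § 2 (a) before pricing):
`−(Str + Col) ≤ −w · visCoreN − BlockRem − InvKin − DropColl + C_fz w ∫Σ(3 + 2‖v‖³) + 2B Σᵢ collisionSum actᵢ` with
`BlockRem = ∫ visFluxN dr + ∫ Σᵢ dt_s dr`, `InvKin = ∫ Σ_(i invisible) kinᵢ dr`, `DropColl = collisionSum Ksf − Σᶠ visCollN`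
EXACTLY the functionals of `frozen_split`.  The bridge between the two landed statements is
`∫Σ fast_s − ∫Σ P_s = ∫Σ dt_s + ∫Σ kin` (`integral_frozenRate_split`: `intervalIntegral.integral_sub/add` with the
interval integrability of continuous one-body sums along a good orbit,
`ClampedCurrentsDockCollisionalIdPrelim.intervalIntegrable_sum_orbit`; `dt_s = fast_s − P_s − kin` is continuous).
Nothing here restates the crux, a stub, a neighbour's stub or the Statement.  References: H.-T. Yau, Lett. Math.
Phys. 22 (1991) § 2–3; C. Kipnis, C. Landim, *Scaling Limits of Interacting Particle Systems* (1999), Ch. 6.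
-/

noncomputable section

open MeasureTheory Filter Set
open scoped ENNReal Topology InnerProductSpace BigOperators

namespace Summit.AtomisticToContinuum.HydrodynamicLimit.Theorems.LTEInBand

open Literature.MathematicalPhysics.KineticTheory Literature.Analysis.FluidPDE Literature.Analysis.FunctionSpaces
open Summit.AtomisticToContinuum.HydrodynamicLimit.Theorems

/-! ## § 1 The bridge: the frozen streaming integral splits into its `∂ₜ`-part and the kinetic current -/

section Bridge

variable {σ : ℝ} {N : ℕ}

/-- **The frozen streaming integral splits**: if `fast_s − P_s = dt_s + kin` pointwise with `fast_s`, `P_s`, `kin`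
continuous, then along a good orbit `∫Σ fast_s − ∫Σ P_s = ∫Σ dt_s + ∫Σ kin` over any window (all four one-body sums
are interval integrable, `ClampedCurrentsDockCollisionalIdPrelim.intervalIntegrable_sum_orbit`: `dt_s = fast_s − P_s − kin`
is continuous). -/
theorem integral_frozenRate_split (Φ : HardSphereFlow (Torus.geometry (Fin 3)) (hsDiameter σ N) (N + 1))
    {fs Ps ds kin : T3 × V3 → ℝ} (hfs : Continuous fs) (hPs : Continuous Ps) (hkin : Continuous kin)
    (hsplit : ∀ y, fs y - Ps y = ds y + kin y) {z : Config (N + 1) (Fin 3) T3} (hz : z ∈ Φ.good) (a b : ℝ) :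
    (∫ r in a..b, ∑ i, fs (Φ.flow r z i)) - (∫ r in a..b, ∑ i, Ps (Φ.flow r z i)) =
      (∫ r in a..b, ∑ i, ds (Φ.flow r z i)) + ∫ r in a..b, ∑ i, kin (Φ.flow r z i) := by
  have hds_eq : ds = fun y => fs y - Ps y - kin y := funext fun y => by linarith [hsplit y]
  have hds : Continuous ds := hds_eq ▸ (hfs.sub hPs).sub hkin
  rw [← intervalIntegral.integral_sub
      (ClampedCurrentsDockCollisionalIdPrelim.intervalIntegrable_sum_orbit Φ hz hfs a b)
      (ClampedCurrentsDockCollisionalIdPrelim.intervalIntegrable_sum_orbit Φ hz hPs a b),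
    ← intervalIntegral.integral_add
      (ClampedCurrentsDockCollisionalIdPrelim.intervalIntegrable_sum_orbit Φ hz hds a b)
      (ClampedCurrentsDockCollisionalIdPrelim.intervalIntegrable_sum_orbit Φ hz hkin a b)]
  refine intervalIntegral.integral_congr fun r _ => ?_
  simp only [← Finset.sum_sub_distrib, ← Finset.sum_add_distrib]
  exact Finset.sum_congr rfl fun i _ => hsplit _

end Bridge

/-! ## § 2 FREEZE ∘ frozen split: the pathwise one-window decomposition inequality -/

section Freeze

variable {σ : ℝ} {N : ℕ}

/-- **FREEZE ∘ frozen split (pathwise, one window `[s, s + w]`, `w = τ (N+1)^{-1/3}`, good orbit)** — steps (1)–(2) of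
the chain of stub 4a-ii and the decomposition inequality of plan § 2 (a) before pricing:
`ClampedCurrentsDockHeart.heart_pathwise` with `lo := fast s`, `hi := 0`, the bridge `integral_frozenRate_split`
(`Dg_s = fast_s − P_s = dt_s + kin`, hypotheses `hDP` at `r = s` and `hDgs`) and `frozen_split`:
`−(Str + Col) ≤ −w · visCoreN(∇λ_s) − (∫ visFluxN + ∫ Σᵢ dt_s) − ∫ Σ_(invisible) kin − (collisionSum Ksf − Σᶠ visCollN)
  + C_fz w ∫Σ(3 + 2‖v‖³) + 2B Σᵢ collisionSum actᵢ`.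
The kernel freeze bound `hK` is asked at every time of the window `(s, s + w]` and every contact pair (the heart needs it
at the collision times only; it is a deterministic contact-scale Lipschitz estimate, `ClampedCurrentsDockHeart.abs_pairKernelGen_le`). -/
theorem freeze_frozen_split (Φ : HardSphereFlow (Torus.geometry (Fin 3)) (hsDiameter σ N) (N + 1))
    (hσ : 0 < σ) (hσ2 : σ < 1 / 2)
    {ρs θ lam0 : T3 → ℝ} {us u : T3 → V3} (hρm : Measurable ρs) (husm : Measurable us)
    (hlam : Torus.IsSmooth lam0) (hθ : Torus.IsSmooth θ) (hu : Torus.IsSmooth u) (hθ0 : ∀ x, 0 < θ x)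
    (R K k : ℝ) {τ s Cfz B : ℝ} (hτ : 0 < τ) (hCfz : 0 ≤ Cfz)
    {Dg P fast dt : ℝ → T3 × V3 → ℝ} {Kt : HardSphereCollisionRecord (Fin 3) T3 (N + 1) → ℝ}
    (hPc : Continuous (P s)) (hfastc : Continuous (fast s))
    {z : Config (N + 1) (Fin 3) T3} (hz : z ∈ Φ.good) :
    let w := τ * ((N : ℝ) + 1) ^ (-(1 / 3 : ℝ))
    let A₀ := Torus.gradient lam0
    let A := fun j : Fin 3 => Torus.gradient fun x => u x j / θ x
    let A₄ := Torus.gradient fun x => -(θ x)⁻¹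
    let kin := fun y : T3 × V3 => ⟪A₀ y.1, y.2⟫_ℝ + (∑ j, ⟪A j y.1, y.2⟫_ℝ * y.2 j) + ⟪A₄ y.1, y.2⟫_ℝ * ‖y.2‖ ^ 2 / 2
    let Ksf := fun c : HardSphereCollisionRecord (Fin 3) T3 (N + 1) =>
      ((∑ k, (u c.fstPos k / θ c.fstPos - u c.sndPos k / θ c.sndPos) * (c.postVel.1 k - c.preVel.1 k)) -
        ((θ c.fstPos)⁻¹ - (θ c.sndPos)⁻¹) * ((‖c.postVel.1‖ ^ 2 - ‖c.preVel.1‖ ^ 2) / 2)) / 2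
    (∀ r ∈ Icc s (s + w), ∀ y, Dg r y = fast r y - P r y) →
    (∀ y, Dg s y = dt s y + kin y) →
    (∀ r ∈ Icc s (s + w), ∀ y, |fast r y - fast s y| ≤ Cfz * |r - s| * (1 + ‖y.2‖ ^ 3)) →
    (∀ r ∈ Icc s (s + w), ∀ y, |P r y - P s y| ≤ Cfz * |r - s| * (1 + ‖y.2‖ ^ 2)) →
    IntervalIntegrable (fun r => ∑ i, Dg r (Φ.flow r z i)) volume s (s + w) →
    (∀ t ∈ Ioc s (s + w), ∀ p ∈ contactPairs (Torus.geometry (Fin 3)) (hsDiameter σ N) (Φ.flow t z),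
      let c := HardSphereCollisionRecord.ofConfig (Torus.geometry (Fin 3)) (hsDiameter σ N) (Φ.flow t z) t p.1 p.2
      |Kt c - Ksf c| ≤ B * (‖c.postVel.1 - c.preVel.1‖ + |‖c.postVel.1‖ ^ 2 - ‖c.preVel.1‖ ^ 2| / 2)) →
    -((∫ r in s..(s + w), ∑ i, Dg r (Φ.flow r z i)) + Φ.collisionSum (Ioc s (s + w)) Kt z) ≤
      -(w * visCoreN σ ρs us A₀ A₄ A R K τ k N Φ s z) -
        ((∫ r in s..(s + w), visFluxN σ ρs us A₀ A₄ A R K k N (Φ.flow r z)) +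
          ∫ r in s..(s + w), ∑ i, dt s (Φ.flow r z i)) -
        (∫ r in s..(s + w), ∑ i, if VisibleN ρs us R K N (Φ.flow r z) i then 0 else kin (Φ.flow r z i)) -
        (Φ.collisionSum (Ioc s (s + w)) Ksf z -
          ∑ᶠ r ∈ collisionTimes (Torus.geometry (Fin 3)) (hsDiameter σ N) (fun r' => Φ.flow r' z) ∩ Ioc s (s + w),
            visCollN σ ρs us A₄ A R K N (Function.leftLim (fun r' => Φ.flow r' z) r) (Φ.flow r z)) +
        Cfz * w * (∫ r in s..(s + w), ∑ i, (3 + 2 * ‖(Φ.flow r z i).2‖ ^ 3)) +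
        2 * B * ∑ i, Φ.collisionSum (Ioc s (s + w)) (fun c => if c.fst = i then
          ‖c.postVel.1 - c.preVel.1‖ + |‖c.postVel.1‖ ^ 2 - ‖c.preVel.1‖ ^ 2| / 2 else 0) z := by
  intro w A₀ A A₄ kin Ksf hDP hDgs hfz1 hfz2 hDg hK
  have hN : (0 : ℝ) < (N : ℝ) + 1 := by positivity
  have hw : 0 < w := mul_pos hτ (Real.rpow_pos_of_pos hN _)
  have hsw : s ≤ s + w := le_add_of_nonneg_right hw.le
  -- continuity of the test fields and of the kinetic current
  have hA₀c : Continuous A₀ := hlam.gradient.continuous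
  have hAc : ∀ j, Continuous (A j) := fun j =>
    (show Torus.IsSmooth (fun x => u x j / θ x) from ContDiff.div (hu.apply j) hθ fun _ => (hθ0 _).ne').gradient.continuous
  have hA₄c : Continuous A₄ :=
    (show Torus.IsSmooth (fun x => -(θ x)⁻¹) from ContDiff.neg (ContDiff.inv hθ fun _ => (hθ0 _).ne')).gradient.continuous
  have hkin : Continuous kin := continuous_kineticCurrent hA₀c hA₄c hAc
  -- step (1): FREEZE, `heart_pathwise` with `lo := fast s`, `hi := 0` (kernel bound restricted to the collision times)
  have hH := ClampedCurrentsDockHeart.heart_pathwise Φ hσ hσ2 (lo := fast s) (hi := fun _ => 0) (Ks := Ksf) hw hCfz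
    hDP (fun y => (add_zero (fast s y)).symm) hPc hfastc continuous_const hfz1 hfz2 hz hDg
    (fun t ht p hp => hK t ht.2 p hp)
  simp only [Finset.sum_const_zero, intervalIntegral.integral_zero, abs_zero, add_zero] at hH
  -- the bridge: `∫Σ fast_s − ∫Σ P_s = ∫Σ dt_s + ∫Σ kin`
  have hB := integral_frozenRate_split Φ hfastc hPc hkin
    (fun y => by rw [← hDP s ⟨le_rfl, hsw⟩ y]; exact hDgs y) hz s (s + w)
  -- step (2): the frozen split
  have hF : (∫ r in s..(s + w), ∑ i, kin (Φ.flow r z i)) + Φ.collisionSum (Set.Ioc s (s + w)) Ksf z =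
      w * visCoreN σ ρs us A₀ A₄ A R K τ k N Φ s z +
        (∫ r in s..(s + w), visFluxN σ ρs us A₀ A₄ A R K k N (Φ.flow r z)) +
        (∫ r in s..(s + w), ∑ i, if VisibleN ρs us R K N (Φ.flow r z) i then 0 else kin (Φ.flow r z i)) +
        (Φ.collisionSum (Set.Ioc s (s + w)) Ksf z -
          ∑ᶠ r ∈ collisionTimes (Torus.geometry (Fin 3)) (hsDiameter σ N) (fun r' => Φ.flow r' z) ∩ Set.Ioc s (s + w),
            visCollN σ ρs us A₄ A R K N (Function.leftLim (fun r' => Φ.flow r' z) r) (Φ.flow r z)) :=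
    frozen_split Φ hρm husm hlam hθ hu hθ0 R K τ k s hz
  linarith

end Freeze

/-! ## The registered helper stub -/

/-- **Registered helper stub `stub_windowClauseFreeze` (FREEZE ∘ frozen split of the plan of stub 4a-ii, skeleton v8, crux
stmt-17740)**: `freeze_frozen_split` — `ClampedCurrentsDockHeart.heart_pathwise` (`lo := fast s`, `hi := 0`) composed with
`frozen_split` through the bridge `integral_frozenRate_split` — restated with fully qualified names (the registered one-line
signature). -/
theorem stub_windowClauseFreeze : ∀ (σ : ℝ) (N : ℕ) (Φ : Literature.Analysis.FluidPDE.HardSphereFlow (Literature.Analysis.FluidPDE.Torus.geometry (Fin 3)) (Literature.MathematicalPhysics.KineticTheory.hsDiameter σ N) (N + 1)), 0 < σ → σ < 1 / 2 → ∀ (ρs θ lam0 : Literature.MathematicalPhysics.KineticTheory.T3 → ℝ) (us u : Literature.MathematicalPhysics.KineticTheory.T3 → Literature.MathematicalPhysics.KineticTheory.V3), Measurable ρs → Measurable us → Literature.Analysis.FunctionSpaces.Torus.IsSmooth lam0 → Literature.Analysis.FunctionSpaces.Torus.IsSmooth θ → Literature.Analysis.FunctionSpaces.Torus.IsSmooth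 u → (∀ x, 0 < θ x) → ∀ (R K k τ s Cfz B : ℝ), 0 < τ → 0 ≤ Cfz → ∀ (Dg P fast dt : ℝ → Literature.MathematicalPhysics.KineticTheory.T3 × Literature.MathematicalPhysics.KineticTheory.V3 → ℝ) (Kt : Literature.Analysis.FluidPDE.HardSphereCollisionRecord (Fin 3) Literature.MathematicalPhysics.KineticTheory.T3 (N + 1) → ℝ), Continuous (P s) → Continuous (fast s) → ∀ z ∈ Φ.good, (let w := τ * ((N : ℝ) + 1) ^ (-(1 / 3 : ℝ)); let A₀ := Literature.Analysis.FunctionSpaces.Torus.gradient lam0; let A := fun j : Fin 3 => Literature.Analysis.FunctionSpaces.Torus.gradient fun x => u x j / θ x; let A₄ := Literature.Analysis.FunctionSpaces.Torus.gradient fun x => -(θ x)⁻¹; let kin := fun y : Literature.MathematicalPhysics.KineticTheory.T3 × Literature.MathematicalPhysics.KineticTheory.V3 => inner ℝ (A₀ y.1) y.2 + (∑ j, inner ℝ (A j y.1) y.2 * y.2 j) + inner ℝ (A₄ y.1) y.2 * ‖y.2‖ ^ 2 / 2; let Ksf := fun c : Literature.Analysis.FluidPDE.HardSphereCollisionRecord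 (Fin 3) Literature.MathematicalPhysics.KineticTheory.T3 (N + 1) => ((∑ k, (u c.fstPos k / θ c.fstPos - u c.sndPos k / θ c.sndPos) * (c.postVel.1 k - c.preVel.1 k)) - ((θ c.fstPos)⁻¹ - (θ c.sndPos)⁻¹) * ((‖c.postVel.1‖ ^ 2 - ‖c.preVel.1‖ ^ 2) / 2)) / 2; (∀ r ∈ Set.Icc s (s + w), ∀ y, Dg r y = fast r y - P r y) → (∀ y, Dg s y = dt s y + kin y) → (∀ r ∈ Set.Icc s (s + w), ∀ y, |fast r y - fast s y| ≤ Cfz * |r - s| * (1 + ‖y.2‖ ^ 3)) → (∀ r ∈ Set.Icc s (s + w), ∀ y, |P r y - P s y| ≤ Cfz * |r - s| * (1 + ‖y.2‖ ^ 2)) → IntervalIntegrable (fun r => ∑ i, Dg r (Φ.flow r z i)) MeasureTheory.volume s (s + w) → (∀ t ∈ Set.Ioc s (s + w), ∀ p ∈ Literature.Analysis.FluidPDE.contactPairs (Literature.Analysis.FluidPDE.Torus.geometry (Fin 3)) (Literature.MathematicalPhysics.KineticTheory.hsDiameter σ N) (Φ.flow t z), (let c := Literature.Analysis.FluidPDE.HardSphereCollisionRecord.ofConfig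 (Literature.Analysis.FluidPDE.Torus.geometry (Fin 3)) (Literature.MathematicalPhysics.KineticTheory.hsDiameter σ N) (Φ.flow t z) t p.1 p.2; |Kt c - Ksf c| ≤ B * (‖c.postVel.1 - c.preVel.1‖ + |‖c.postVel.1‖ ^ 2 - ‖c.preVel.1‖ ^ 2| / 2))) → -((∫ r in s..(s + w), ∑ i, Dg r (Φ.flow r z i)) + Φ.collisionSum (Set.Ioc s (s + w)) Kt z) ≤ -(w * Summit.AtomisticToContinuum.HydrodynamicLimit.Theorems.LTEInBand.visCoreN σ ρs us A₀ A₄ A R K τ k N Φ s z) - ((∫ r in s..(s + w), Summit.AtomisticToContinuum.HydrodynamicLimit.Theorems.LTEInBand.visFluxN σ ρs us A₀ A₄ A R K k N (Φ.flow r z)) + ∫ r in s..(s + w), ∑ i, dt s (Φ.flow r z i)) - (∫ r in s..(s + w), ∑ i, if Summit.AtomisticToContinuum.HydrodynamicLimit.Theorems.LTEInBand.VisibleN ρs us R K N (Φ.flow r z) i then 0 else kin (Φ.flow r z i)) - (Φ.collisionSum (Set.Ioc s (s + w)) Ksf z - ∑ᶠ r ∈ Literature.Analysis.FluidPDE.collisionTimes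 (Literature.Analysis.FluidPDE.Torus.geometry (Fin 3)) (Literature.MathematicalPhysics.KineticTheory.hsDiameter σ N) (fun r' => Φ.flow r' z) ∩ Set.Ioc s (s + w), Summit.AtomisticToContinuum.HydrodynamicLimit.Theorems.LTEInBand.visCollN σ ρs us A₄ A R K N (Function.leftLim (fun r' => Φ.flow r' z) r) (Φ.flow r z)) + Cfz * w * (∫ r in s..(s + w), ∑ i, (3 + 2 * ‖(Φ.flow r z i).2‖ ^ 3)) + 2 * B * ∑ i, Φ.collisionSum (Set.Ioc s (s + w)) (fun c => if c.fst = i then ‖c.postVel.1 - c.preVel.1‖ + |‖c.postVel.1‖ ^ 2 - ‖c.preVel.1‖ ^ 2| / 2 else 0) z) :=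
  fun _ _ Φ hσ hσ2 _ _ _ _ _ hρm husm hlam hθ hu hθ0 R K k _ _ _ _ hτ hCfz _ _ _ _ _ hPc hfastc _ hz =>
    freeze_frozen_split Φ hσ hσ2 hρm husm hlam hθ hu hθ0 R K k hτ hCfz hPc hfastc hz

end Summit.AtomisticToContinuum.HydrodynamicLimit.Theorems.LTEInBand

end
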